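import Summits.FinalStateConjecture.FinalStateConjecture.Theorems.DerivativeThriftThriftyClusterSettlingOuterFlatnessForced
import HarnessLib

/-!
# Crux `ThriftyClusterSettling` (stmt-FinalStateConjecture-17611, route DerivativeThrift): the EXACT SPLITTING
# of the crux as filed into its recorded repair and the unfed outer-zone conjunct (kernel form of the
# restatement recipe of line `registered`)

Four successive line leads (c1–c4) of the crux found its only line dying at the stub `stub_outerZoneFlatness`
(late sup-`C²` flatness of the cone complement `{|x̲| > (1 − θ) x⁰}` of every maximal development of admissible
data with complete `𝓘⁺`), fed by no hypothesis of the crux, while lead c3 landed the converse as a kernel fact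
(`thriftyClusterSettling_forces_outerFlatness`: the crux's consequent CONTAINS such a certificate).  This file
turns the restatement recipe ("restate as Repair A/B: add the outer chart to the antecedent") into an
equivalence of propositions, so that the planner's `--restate` is checked arithmetic on statements:

* `thriftyClusterSettling_iff_repairA_and_forcedOuterFlatness`:
  `ThriftyClusterSettling ↔ RepairA ∧ ForcedOuterFlatness`, where `RepairA` is the crux with the outer-zone
  flatness certificate ADDED to its antecedent (the registrar's recorded repair, `Lines/registered.lean`
  Appendix, `ThriftyClusterSettlingRepairA`, written here with the tree's `FullHandoff` for the hand-over and the
  certificate unfolded) and `ForcedOuterFlatness` is `ThriftyKerrStability → every maximal development of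
  admissible data with complete 𝓘⁺ and a thrifty hand-over is outer-flat` — the conjunct no hypothesis feeds.
* `thriftyClusterSettling_iff_forcedOuterFlatness_of_repairA`: GRANTED the repaired crux, the crux as filed is
  EQUIVALENT to `ForcedOuterFlatness` — what was filed minus what was meant is exactly the unfed conjunct
  (on paper refuted pointwise by far-field focusing packets, line dossiers `Lines/registered-dead*.md`).
* `repairA_of_thriftyClusterSettling`, `forcedOuterFlatness_of_thriftyClusterSettling`: the two projections.

Pure logic over `thriftyClusterSettling_forces_outerFlatness` (p150580); no analysis is claimed.  Chart
vocabulary: DHRT arXiv:2104.08222, §1; Dafermos–Luk arXiv:1710.01722, Conjecture 1 (the final-state picture).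
Line lead prover-line-stmt-FinalStateConjecture-17611-c4-0, 2026-08-17.
-/

noncomputable section

-- the doubled `FinalStateConjecture` path component is the summit/problem naming scheme
set_option linter.dupNamespace false

namespace Summit.FinalStateConjecture.FinalStateConjecture.Theorems.DerivativeThrift.ThriftyClusterSettling

open Set Filter Topology TopologicalSpace
open scoped Manifold ContDiff ENNReal
open Literature.Geometry.Lorentzian

/-- **The crux as filed splits exactly into its recorded repair and the unfed outer-zone conjunct.**
`ThriftyClusterSettling ↔ RepairA ∧ ForcedOuterFlatness`: (→) Repair A forgets the added certificate, and the
forced outer flatness is `thriftyClusterSettling_forces_outerFlatness`; (←) given a thrifty hand-over, the second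
conjunct supplies the certificate Repair A consumes.  The hand-over is the tree's
`Theorems.DerivativeThriftThriftyHandoff.FullHandoff` (verbatim the crux's antecedent); the certificate is the line's
`OuterFlatness` unfolded (aperture `θ > 0`, a late flat chart on an open `V ⊇ {x⁰ > τₑ, |x̲| > (1 − θ) x⁰}` into
`J⁺(ι X)`, full-slab `C²` deviation `→ 0`, `∂₀` eventually future-directed).  Dafermos–Luk arXiv:1710.01722,
Conjecture 1; DHRT arXiv:2104.08222, §1. [folklore] -/
theorem thriftyClusterSettling_iff_repairA_and_forcedOuterFlatness : Theses.DerivativeThrift.ThriftyClusterSettling ↔ ((Theses.DerivativeThrift.ThriftyKerrStability → ∀ (X : Type) [TopologicalSpace X] [ChartedSpace E3 X] [IsManifold (𝓡 3) ∞ X] [T2Space X] [SecondCountableTopology X] [ConnectedSpace X] (D : InitialDataSet (𝓡 3) X), D ∈ admissibleVacuumData X → ∀ 𝒟 : VacuumCauchyDevelopment D, 𝒟.IsMaximal → HasCompleteNullInfinity 𝒟.toCauchyDevelopment → Theorems.DerivativeThriftThriftyHandoff.FullHandoff 𝒟 → (∃ (θ τₑ : ℝ) (V : Opens E4) (Φₑ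 : V → 𝒟.carrier), 0 < θ ∧ {x : E4 | τₑ < x 0 ∧ (1 - θ) * x 0 < E4.spatialNorm x} ⊆ (V : Set E4) ∧ 𝒟.toSpacetime.IsLateChart (Minkowski.backgroundOn V) (𝒟.metric.causalFuture 𝒟.timeOrientation (Set.range 𝒟.embed)) τₑ Φₑ ∧ Tendsto (fun τ ↦ 𝒟.toSpacetime.deviationCk (Minkowski.backgroundOn V) Φₑ 2 τ) atTop (𝓝 0) ∧ ∀ᶠ τ in atTop, ∀ x ∈ (Minkowski.backgroundOn V).timeSlab τ, 𝒟.timeOrientation.IsFutureDirected (mfderiv 𝓘(ℝ, E4) (𝓡 4) Φₑ x (E4.basisVector 0))) → ∃ (O : Set 𝒟.carrier) (d : FinalStateDecomposition 𝒟.toSpacetime O 2), (∀ i, Kerr.IsSubextremal (d.mass i) (d.spin i)) ∧ O = exteriorOf 𝒟.toCauchyDevelopment d.charted ∧ HasExhaustiveCharts d ∧ IsFutureOriented d) ∧ (Theses.DerivativeThrift.ThriftyKerrStability → ∀ (X : Type) [TopologicalSpace X] [ChartedSpace E3 X] [IsManifold (𝓡 3) ∞ X] [T2Space X] [SecondCountableTopology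 X] [ConnectedSpace X] (D : InitialDataSet (𝓡 3) X), D ∈ admissibleVacuumData X → ∀ 𝒟 : VacuumCauchyDevelopment D, 𝒟.IsMaximal → HasCompleteNullInfinity 𝒟.toCauchyDevelopment → Theorems.DerivativeThriftThriftyHandoff.FullHandoff 𝒟 → ∃ (θ τₑ : ℝ) (V : Opens E4) (Φₑ : V → 𝒟.carrier), 0 < θ ∧ {x : E4 | τₑ < x 0 ∧ (1 - θ) * x 0 < E4.spatialNorm x} ⊆ (V : Set E4) ∧ 𝒟.toSpacetime.IsLateChart (Minkowski.backgroundOn V) (𝒟.metric.causalFuture 𝒟.timeOrientation (Set.range 𝒟.embed)) τₑ Φₑ ∧ Tendsto (fun τ ↦ 𝒟.toSpacetime.deviationCk (Minkowski.backgroundOn V) Φₑ 2 τ) atTop (𝓝 0) ∧ ∀ᶠ τ in atTop, ∀ x ∈ (Minkowski.backgroundOn V).timeSlab τ, 𝒟.timeOrientation.IsFutureDirected (mfderiv 𝓘(ℝ, E4) (𝓡 4) Φₑ x (E4.basisVector 0)))) := by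
  constructor
  · intro h
    refine ⟨fun hK X _ _ _ _ _ _ D hD 𝒟 h𝒟 h𝓘 hF _ ↦ h hK X D hD 𝒟 h𝒟 h𝓘 hF, ?_⟩
    exact thriftyClusterSettling_forces_outerFlatness h
  · rintro ⟨hA, hO⟩ hK X _ _ _ _ _ _ D hD 𝒟 h𝒟 h𝓘 hF
    exact hA hK X D hD 𝒟 h𝒟 h𝓘 hF (hO hK X D hD 𝒟 h𝒟 h𝓘 hF)

/-- **Projection 1: the crux as filed implies its recorded repair** (Repair A: the outer-zone certificate
added to the antecedent is simply not used).  Dafermos–Luk arXiv:1710.01722, Conjecture 1. [folklore] -/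
theorem repairA_of_thriftyClusterSettling (h : Theses.DerivativeThrift.ThriftyClusterSettling) : Theses.DerivativeThrift.ThriftyKerrStability → ∀ (X : Type) [TopologicalSpace X] [ChartedSpace E3 X] [IsManifold (𝓡 3) ∞ X] [T2Space X] [SecondCountableTopology X] [ConnectedSpace X] (D : InitialDataSet (𝓡 3) X), D ∈ admissibleVacuumData X → ∀ 𝒟 : VacuumCauchyDevelopment D, 𝒟.IsMaximal → HasCompleteNullInfinity 𝒟.toCauchyDevelopment → Theorems.DerivativeThriftThriftyHandoff.FullHandoff 𝒟 → (∃ (θ τₑ : ℝ) (V : Opens E4) (Φₑ : V → 𝒟.carrier), 0 < θ ∧ {x : E4 | τₑ < x 0 ∧ (1 - θ) * x 0 < E4.spatialNorm x} ⊆ (V : Set E4) ∧ 𝒟.toSpacetime.IsLateChart (Minkowski.backgroundOn V) (𝒟.metric.causalFuture 𝒟.timeOrientation (Set.range 𝒟.embed)) τₑ Φₑ ∧ Tendsto (fun τ ↦ 𝒟.toSpacetime.deviationCk (Minkowski.backgroundOn V) Φₑ 2 τ) atTop (𝓝 0) ∧ ∀ᶠ τ in atTop, ∀ x ∈ (Minkowski.backgroundOn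 V).timeSlab τ, 𝒟.timeOrientation.IsFutureDirected (mfderiv 𝓘(ℝ, E4) (𝓡 4) Φₑ x (E4.basisVector 0))) → ∃ (O : Set 𝒟.carrier) (d : FinalStateDecomposition 𝒟.toSpacetime O 2), (∀ i, Kerr.IsSubextremal (d.mass i) (d.spin i)) ∧ O = exteriorOf 𝒟.toCauchyDevelopment d.charted ∧ HasExhaustiveCharts d ∧ IsFutureOriented d :=
  (thriftyClusterSettling_iff_repairA_and_forcedOuterFlatness.1 h).1

/-- **Projection 2: the crux as filed implies the unfed conjunct** (a renaming of
`thriftyClusterSettling_forces_outerFlatness`, kept for symmetry with projection 1).  DHRT arXiv:2104.08222,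
§1. [folklore] -/
theorem forcedOuterFlatness_of_thriftyClusterSettling (h : Theses.DerivativeThrift.ThriftyClusterSettling) : Theses.DerivativeThrift.ThriftyKerrStability → ∀ (X : Type) [TopologicalSpace X] [ChartedSpace E3 X] [IsManifold (𝓡 3) ∞ X] [T2Space X] [SecondCountableTopology X] [ConnectedSpace X] (D : InitialDataSet (𝓡 3) X), D ∈ admissibleVacuumData X → ∀ 𝒟 : VacuumCauchyDevelopment D, 𝒟.IsMaximal → HasCompleteNullInfinity 𝒟.toCauchyDevelopment → Theorems.DerivativeThriftThriftyHandoff.FullHandoff 𝒟 → ∃ (θ τₑ : ℝ) (V : Opens E4) (Φₑ : V → 𝒟.carrier), 0 < θ ∧ {x : E4 | τₑ < x 0 ∧ (1 - θ) * x 0 < E4.spatialNorm x} ⊆ (V : Set E4) ∧ 𝒟.toSpacetime.IsLateChart (Minkowski.backgroundOn V) (𝒟.metric.causalFuture 𝒟.timeOrientation (Set.range 𝒟.embed)) τₑ Φₑ ∧ Tendsto (fun τ ↦ 𝒟.toSpacetime.deviationCk (Minkowski.backgroundOn V) Φₑ 2 τ) atTop (𝓝 0) ∧ ∀ᶠ τ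 in atTop, ∀ x ∈ (Minkowski.backgroundOn V).timeSlab τ, 𝒟.timeOrientation.IsFutureDirected (mfderiv 𝓘(ℝ, E4) (𝓡 4) Φₑ x (E4.basisVector 0)) :=
  (thriftyClusterSettling_iff_repairA_and_forcedOuterFlatness.1 h).2

/-- **Granted the repaired crux, the crux as filed IS the unfed conjunct.**  If Repair A holds (the crux with
the outer-zone certificate in its antecedent — what the line `registered` reduces to its stub 1' plus the landed
stub 3'), then `ThriftyClusterSettling` as filed is equivalent to `ForcedOuterFlatness`: granted
`ThriftyKerrStability`, every maximal development of admissible data with complete `𝓘⁺` and a thrifty hand-over is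
outer-flat.  This is the precise surplus of the item over its intended content.  Dafermos–Luk arXiv:1710.01722,
Conjecture 1; DHRT arXiv:2104.08222, §1. [folklore] -/
theorem thriftyClusterSettling_iff_forcedOuterFlatness_of_repairA (hA : Theses.DerivativeThrift.ThriftyKerrStability → ∀ (X : Type) [TopologicalSpace X] [ChartedSpace E3 X] [IsManifold (𝓡 3) ∞ X] [T2Space X] [SecondCountableTopology X] [ConnectedSpace X] (D : InitialDataSet (𝓡 3) X), D ∈ admissibleVacuumData X → ∀ 𝒟 : VacuumCauchyDevelopment D, 𝒟.IsMaximal → HasCompleteNullInfinity 𝒟.toCauchyDevelopment → Theorems.DerivativeThriftThriftyHandoff.FullHandoff 𝒟 → (∃ (θ τₑ : ℝ) (V : Opens E4) (Φₑ : V → 𝒟.carrier), 0 < θ ∧ {x : E4 | τₑ < x 0 ∧ (1 - θ) * x 0 < E4.spatialNorm x} ⊆ (V : Set E4) ∧ 𝒟.toSpacetime.IsLateChart (Minkowski.backgroundOn V) (𝒟.metric.causalFuture 𝒟.timeOrientation (Set.range 𝒟.embed)) τₑ Φₑ ∧ Tendsto (fun τ ↦ 𝒟.toSpacetime.deviationCk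 (Minkowski.backgroundOn V) Φₑ 2 τ) atTop (𝓝 0) ∧ ∀ᶠ τ in atTop, ∀ x ∈ (Minkowski.backgroundOn V).timeSlab τ, 𝒟.timeOrientation.IsFutureDirected (mfderiv 𝓘(ℝ, E4) (𝓡 4) Φₑ x (E4.basisVector 0))) → ∃ (O : Set 𝒟.carrier) (d : FinalStateDecomposition 𝒟.toSpacetime O 2), (∀ i, Kerr.IsSubextremal (d.mass i) (d.spin i)) ∧ O = exteriorOf 𝒟.toCauchyDevelopment d.charted ∧ HasExhaustiveCharts d ∧ IsFutureOriented d) : Theses.DerivativeThrift.ThriftyClusterSettling ↔ (Theses.DerivativeThrift.ThriftyKerrStability → ∀ (X : Type) [TopologicalSpace X] [ChartedSpace E3 X] [IsManifold (𝓡 3) ∞ X] [T2Space X] [SecondCountableTopology X] [ConnectedSpace X] (D : InitialDataSet (𝓡 3) X), D ∈ admissibleVacuumData X → ∀ 𝒟 : VacuumCauchyDevelopment D, 𝒟.IsMaximal → HasCompleteNullInfinity 𝒟.toCauchyDevelopment → Theorems.DerivativeThriftThriftyHandoff.FullHandoff 𝒟 → ∃ (θ τₑ : ℝ) (V : Opens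 E4) (Φₑ : V → 𝒟.carrier), 0 < θ ∧ {x : E4 | τₑ < x 0 ∧ (1 - θ) * x 0 < E4.spatialNorm x} ⊆ (V : Set E4) ∧ 𝒟.toSpacetime.IsLateChart (Minkowski.backgroundOn V) (𝒟.metric.causalFuture 𝒟.timeOrientation (Set.range 𝒟.embed)) τₑ Φₑ ∧ Tendsto (fun τ ↦ 𝒟.toSpacetime.deviationCk (Minkowski.backgroundOn V) Φₑ 2 τ) atTop (𝓝 0) ∧ ∀ᶠ τ in atTop, ∀ x ∈ (Minkowski.backgroundOn V).timeSlab τ, 𝒟.timeOrientation.IsFutureDirected (mfderiv 𝓘(ℝ, E4) (𝓡 4) Φₑ x (E4.basisVector 0))) :=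
  ⟨forcedOuterFlatness_of_thriftyClusterSettling,
    fun hO ↦ thriftyClusterSettling_iff_repairA_and_forcedOuterFlatness.2 ⟨hA, hO⟩⟩

end Summit.FinalStateConjecture.FinalStateConjecture.Theorems.DerivativeThrift.ThriftyClusterSettling

end
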